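import Mathlib
import Summits.Ventures.PercRepro2.AsymPins

/-!
# The two-term form of the i = 0 core (seat mine-b, cell pub-perc-repro2; conjectures/MINE-B.md §14 Addendum 6)

For an increasing `A`, pins `O`, a split set `Y` and a red-only pin `q`, write `A₀ = A (O ∪ ·)` and
`A₁ = A (insert q O ∪ ·)` on the cube `Y` (`A₀ ⊆ A₁`).  The (AS3) statement for the pair `(A₀, A₁)` — the
(RS) form of the i = 0 row of STEP (RSForm.lean) — is equivalent to the **two-term inequality**

  `#{γ ⊆ Y : A₀ □ A₁ at γ ∧ ρ ∉ A₁} + #{γ ⊆ Y : A₁ □ A₁ at γ ∧ ρ ∈ A₀} ≤ #{γ ⊆ Y : γ ∈ A₀ ∧ ρ ∈ A₁}`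

(`AS3_pair_iff_two_term`): Reimer's target count for `(A₀, A₁)` must dominate the `(A₀, A₁)`-occurrences
whose red side misses `A₁` TOGETHER with the `(A₁, A₁)`-occurrences whose red side lies in `A₀`.  When `q`
is irrelevant (`A₀ = A₁`) the two terms add up to `#{A₀ □ A₀}` and the statement is Reimer's inequality;
in general the second term uses the bigger event `A₁ □ A₁ ⊇ A₀ □ A₁` on a smaller red set `A₀ ⊆ A₁`.
-/

open Finset

namespace Summit.Ventures.PercRepro2

namespace StepZero

open ReimerCube

variable {E : Type*} [DecidableEq E]

open Classical

/-- **the two-term form**: `(AS3)` for the pinned pair `(A (O ∪ ·), A (insert q O ∪ ·))` on the cube `Y`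
is `#{A₀ □ A₁ ∧ ρ ∉ A₁} + #{A₁ □ A₁ ∧ ρ ∈ A₀} ≤ #{γ ∈ A₀ ∧ ρ ∈ A₁}`. -/
theorem AS3_pair_iff_two_term (A : Finset E → Prop) (O Y : Finset E) (q : E) :
    AS3 Y (fun X => A (O ∪ X)) (fun X => A (insert q O ∪ X)) ↔
      (Y.powerset.filter (fun γ => DOcc (fun X => A (O ∪ X)) (fun X => A (insert q O ∪ X)) γ ∧
          ¬ A (insert q O ∪ (Y \ γ)))).card
        + (Y.powerset.filter (fun γ => DOcc (fun X => A (insert q O ∪ X))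
            (fun X => A (insert q O ∪ X)) γ ∧ A (O ∪ (Y \ γ)))).card
        ≤ (Y.powerset.filter (fun γ => A (O ∪ γ) ∧ A (insert q O ∪ (Y \ γ)))).card := by
  unfold AS3
  beta_reduce
  -- the (AS3) targets are the Reimer targets minus the configurations whose red side carries `A₁ □ A₁`
  have hsplit : (Y.powerset.filter (fun γ => A (O ∪ γ) ∧ A (insert q O ∪ (Y \ γ)) ∧
      ¬ DOcc (fun X => A (insert q O ∪ X)) (fun X => A (insert q O ∪ X)) (Y \ γ))).card
      + (Y.powerset.filter (fun γ => A (O ∪ γ) ∧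
          DOcc (fun X => A (insert q O ∪ X)) (fun X => A (insert q O ∪ X)) (Y \ γ))).card
      = (Y.powerset.filter (fun γ => A (O ∪ γ) ∧ A (insert q O ∪ (Y \ γ)))).card := by
    rw [← Finset.card_filter_add_card_filter_not
      (fun γ => DOcc (fun X => A (insert q O ∪ X)) (fun X => A (insert q O ∪ X)) (Y \ γ))
      (s := Y.powerset.filter (fun γ => A (O ∪ γ) ∧ A (insert q O ∪ (Y \ γ)))),
      Finset.filter_filter, Finset.filter_filter, Nat.add_comm]
    congr 1
    · apply congrArg Finset.card
      apply Finset.filter_congr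
      intro γ _
      constructor
      · rintro ⟨h1, h2⟩
        exact ⟨⟨h1, (A_and_B_of_dOcc h2).1⟩, h2⟩
      · rintro ⟨⟨h1, -⟩, h2⟩; exact ⟨h1, h2⟩
    · apply congrArg Finset.card
      apply Finset.filter_congr
      intro γ _
      constructor
      · rintro ⟨h1, h2, h3⟩; exact ⟨⟨h1, h2⟩, h3⟩
      · rintro ⟨⟨h1, h2⟩, h3⟩; exact ⟨h1, h2, h3⟩
  -- the colour swap on the subtracted set
  have hsw : (Y.powerset.filter (fun γ => A (O ∪ γ) ∧
      DOcc (fun X => A (insert q O ∪ X)) (fun X => A (insert q O ∪ X)) (Y \ γ))).card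
      = (Y.powerset.filter (fun γ => DOcc (fun X => A (insert q O ∪ X))
          (fun X => A (insert q O ∪ X)) γ ∧ A (O ∪ (Y \ γ)))).card :=
    card_filter_swap (fun X => A (O ∪ X))
      (fun X => DOcc (fun X => A (insert q O ∪ X)) (fun X => A (insert q O ∪ X)) X) Y
  omega

end StepZero

end Summit.Ventures.PercRepro2
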